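import Mathlib
import Summits.RiemannHypothesis.RiemannHypothesis.Theorems.WeilFarFloorCramerFunction
import HarnessLib

/-!
# The lag-`2b` cross term of the Cramér autocorrelation averages out when the primitive of `g` is bounded (Fubini; RH-free)

Helper file (`--supports stmt-RiemannHypothesis-0098`, lead-track anchor: Weil-positivity window ladder, format-C far bound),
pure proofs.  Seat rh-explicit-weil-1 gen16 (memo `run/shared/lean/pub/rh-explicit/rh-explicit-weil-1/FORMAT-K3.md` §17).

With `g(u) = e^{−u/2}(ψ(e^u) − e^u)` and `X(b) = ∫₀^{2b} g(u)g(2b−u) du` (the cross term of `Φ(b) = 2F(2b) + 2X(b)`,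
`WeilFarFloorCramerFunction`), this file proves ★ `abs_integral_cross_le_of_primitive_bound`:
**if `|∫₀^V g| ≤ C` for all `V ≥ 0` then `∀ A ≥ 1, X is integrable on [1, A] and |∫₁^A X(b) db| ≤ C · ∫₀^{2A} |g|`** (RH-free;
under RH the hypothesis is `WeilFarFloorCramerPrimitiveRH.exists_abs_integral_cramerFn_le_of_RH`): Fubini on `D = {1 < b < A, 0 < u < 2b}` (the integrand `1_D·g(u)g(2b−u)` is
bounded measurable with bounded support), the `u`-slices `∫_{b∈(max(1,u/2),A)} g(2b−u) db = ½(G(2A−u) − G((2−u)₊))`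
(`WeilFarFloorCramerFunction.setIntegral_cramerFn_two_mul_sub`).  Standard axioms only.  Nothing here bears on the truth of RH.
-/

set_option linter.dupNamespace false
set_option autoImplicit false

noncomputable section

open MeasureTheory Set Filter Topology
open scoped Real BigOperators ArithmeticFunction.vonMangoldt Chebyshev

namespace Summit.RiemannHypothesis.RiemannHypothesis.Theorems.WeilFormatC

namespace FloorResidualMean


variable {b : ℝ}

/-! ## The lag-`2b` cross term averages out (Fubini + the bounded primitive) -/

/-- **The `b`-average of the cross term is controlled by the primitive of `g`** (RH-free, hypothesis-explicit): if
`|∫₀^V g| ≤ C` for all `V ≥ 0`, then for `A ≥ 1` the cross term `X(b) = ∫₀^{2b} g(u)g(2b−u) du` is integrable on `[1, A]` and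
`|∫₁^A X(b) db| ≤ C · ∫₀^{2A} |g(u)| du`.  Fubini on `{1 < b < A, 0 < u < 2b}` and `∫_b g(2b−u) db = ½(G(2A−u) − G((2−u)₊))`.
Under RH the hypothesis holds (`WeilFarFloorCramerPrimitiveRH.exists_abs_integral_cramerFn_le_of_RH`). -/
theorem abs_integral_cross_le_of_primitive_bound {C : ℝ}
    (hC : ∀ V : ℝ, 0 ≤ V → |∫ u in (0 : ℝ)..V, Real.exp (-(u / 2)) * (ψ (Real.exp u) - Real.exp u)| ≤ C)
    {A : ℝ} (hA : 1 ≤ A) :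
    IntervalIntegrable (fun b : ℝ ↦ ∫ u in (0 : ℝ)..(2 * b),
        (Real.exp (-(u / 2)) * (ψ (Real.exp u) - Real.exp u))
          * (Real.exp (-((2 * b - u) / 2)) * (ψ (Real.exp (2 * b - u)) - Real.exp (2 * b - u)))) volume 1 A ∧
    |∫ b in (1 : ℝ)..A, ∫ u in (0 : ℝ)..(2 * b),
        (Real.exp (-(u / 2)) * (ψ (Real.exp u) - Real.exp u))
          * (Real.exp (-((2 * b - u) / 2)) * (ψ (Real.exp (2 * b - u)) - Real.exp (2 * b - u)))|
      ≤ C * ∫ u in (0 : ℝ)..(2 * A), |Real.exp (-(u / 2)) * (ψ (Real.exp u) - Real.exp u)| := by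
  have hC0 : 0 ≤ C := le_trans (abs_nonneg _) (hC 0 le_rfl)
  set g : ℝ → ℝ := fun v ↦ Real.exp (-(v / 2)) * (ψ (Real.exp v) - Real.exp v) with hg
  have hgm : Measurable g := measurable_cramerFn
  -- the region and the integrand on ℝ × ℝ (p = (b, u))
  set D : Set (ℝ × ℝ) := {p | 1 < p.1 ∧ p.1 < A ∧ 0 < p.2 ∧ p.2 < 2 * p.1} with hD
  have hDm : MeasurableSet D := by
    have h1 : MeasurableSet {p : ℝ × ℝ | 1 < p.1} := measurableSet_lt measurable_const measurable_fst
    have h2 : MeasurableSet {p : ℝ × ℝ | p.1 < A} := measurableSet_lt measurable_fst measurable_const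
    have h3 : MeasurableSet {p : ℝ × ℝ | 0 < p.2} := measurableSet_lt measurable_const measurable_snd
    have h4 : MeasurableSet {p : ℝ × ℝ | p.2 < 2 * p.1} :=
      measurableSet_lt measurable_snd (measurable_fst.const_mul 2)
    have : D = {p : ℝ × ℝ | 1 < p.1} ∩ {p | p.1 < A} ∩ {p | 0 < p.2} ∩ {p | p.2 < 2 * p.1} := by
      ext p; simp only [hD, mem_setOf_eq, mem_inter_iff]; tauto
    rw [this]
    exact ((h1.inter h2).inter h3).inter h4
  set h : ℝ × ℝ → ℝ := fun p ↦ g p.2 * g (2 * p.1 - p.2) with hh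
  have hhm : Measurable h :=
    (hgm.comp measurable_snd).mul (hgm.comp ((measurable_fst.const_mul 2).sub measurable_snd))
  set H : ℝ × ℝ → ℝ := D.indicator h with hH
  -- H is integrable on the product
  set K := ψ (Real.exp (2 * A)) + Real.exp (2 * A) with hK
  have hK0 : 0 ≤ K := by have := Chebyshev.psi_nonneg (Real.exp (2 * A)); positivity
  have hHint : Integrable H (volume.prod volume) := by
    have hsub : D ⊆ Icc 1 A ×ˢ Icc 0 (2 * A) := by
      intro p hp
      simp only [hD, mem_setOf_eq] at hp
      exact ⟨⟨hp.1.le, hp.2.1.le⟩, ⟨hp.2.2.1.le, by linarith [hp.2.2.2, hp.2.1]⟩⟩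
    have hfin : (volume.prod volume) D ≠ ⊤ := by
      refine ne_top_of_le_ne_top ?_ (measure_mono hsub)
      rw [Measure.prod_prod, Real.volume_Icc, Real.volume_Icc]
      exact ENNReal.mul_ne_top ENNReal.ofReal_ne_top ENNReal.ofReal_ne_top
    have hbd : ∀ᵐ p ∂((volume.prod volume).restrict D), ‖h p‖ ≤ K * K := by
      refine (ae_restrict_iff' hDm).2 (ae_of_all _ fun p hp ↦ ?_)
      simp only [hD, mem_setOf_eq] at hp
      rw [Real.norm_eq_abs, hh]
      simp only
      rw [abs_mul]
      have hA2 : 0 ≤ 2 * A := by linarith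
      have hu : |g p.2| ≤ K := abs_cramerFn_le hA2 (by linarith [hp.2.2.2, hp.2.1])
      have hv : |g (2 * p.1 - p.2)| ≤ K := abs_cramerFn_le hA2 (by linarith [hp.2.1, hp.2.2.1])
      exact mul_le_mul hu hv (abs_nonneg _) ((abs_nonneg _).trans hu)
    exact (Measure.integrableOn_of_bounded hfin hhm.aestronglyMeasurable hbd).integrable_indicator hDm
  -- the b-slices: for fixed b, ∫ u, H (b,u) = 1_{(1,A)}(b) · X(b)
  have hslice_b : ∀ b : ℝ, ∫ u, H (b, u) = (Ioo 1 A).indicator (fun b ↦ ∫ u in (0 : ℝ)..(2 * b), g u * g (2 * b - u)) b := by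
    intro b
    by_cases hb : b ∈ Ioo 1 A
    · rw [indicator_of_mem hb]
      have hb0 : 0 ≤ 2 * b := by linarith [hb.1]
      have hpt : (fun u ↦ H (b, u)) = (Ioo 0 (2 * b)).indicator (fun u ↦ g u * g (2 * b - u)) := by
        funext u
        by_cases hu : u ∈ Ioo 0 (2 * b)
        · rw [indicator_of_mem hu, hH, indicator_of_mem (show (b, u) ∈ D from ⟨hb.1, hb.2, hu.1, hu.2⟩)]
        · rw [indicator_of_notMem hu, hH, indicator_of_notMem]
          intro hmem; exact hu ⟨hmem.2.2.1, hmem.2.2.2⟩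
      rw [hpt, integral_indicator measurableSet_Ioo, intervalIntegral.integral_of_le hb0, integral_Ioc_eq_integral_Ioo]
    · rw [indicator_of_notMem hb]
      have hpt : (fun u ↦ H (b, u)) = fun _ ↦ 0 := by
        funext u
        rw [hH, indicator_of_notMem]
        intro hmem; exact hb ⟨hmem.1, hmem.2.1⟩
      rw [hpt, integral_zero]
  -- the u-slices: for fixed u, ∫ b, H (b,u) = 1_{(0,2A)}(u) · g(u) · ∫_{b ∈ (max 1 (u/2), A)} g(2b − u) db
  have hslice_u : ∀ u : ℝ, ∫ b, H (b, u)
      = (Ioo 0 (2 * A)).indicator (fun u ↦ g u * ∫ b in Ioo (max 1 (u / 2)) A, g (2 * b - u)) u := by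
    intro u
    by_cases hu : u ∈ Ioo 0 (2 * A)
    · rw [indicator_of_mem hu]
      have hpt : (fun b ↦ H (b, u)) = (Ioo (max 1 (u / 2)) A).indicator (fun b ↦ g u * g (2 * b - u)) := by
        funext b
        by_cases hb : b ∈ Ioo (max 1 (u / 2)) A
        · have h1 : 1 < b := lt_of_le_of_lt (le_max_left _ _) hb.1
          have h2 : u / 2 < b := lt_of_le_of_lt (le_max_right _ _) hb.1
          rw [indicator_of_mem hb, hH, indicator_of_mem (show (b, u) ∈ D from ⟨h1, hb.2, hu.1, by linarith⟩)]
        · rw [indicator_of_notMem hb, hH, indicator_of_notMem]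
          intro hmem
          exact hb ⟨max_lt hmem.1 (by linarith [hmem.2.2.2]), hmem.2.1⟩
      rw [hpt, integral_indicator measurableSet_Ioo, MeasureTheory.integral_const_mul]
    · rw [indicator_of_notMem hu]
      have hpt : (fun b ↦ H (b, u)) = fun _ ↦ 0 := by
        funext b
        rw [hH, indicator_of_notMem]
        intro hmem
        simp only [mem_Ioo, not_and, not_lt] at hu
        rcases lt_or_ge 0 u with h0 | h0
        · have := hu hmem.2.2.1; linarith [hmem.2.2.2, hmem.2.1]
        · linarith [hmem.2.2.1]
      rw [hpt, integral_zero]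
  -- Fubini
  have hunc : (Function.uncurry fun b u ↦ H (b, u)) = H := by funext p; rfl
  have hswap : ∫ b, ∫ u, H (b, u) = ∫ u, ∫ b, H (b, u) :=
    integral_integral_swap (f := fun b u ↦ H (b, u)) (by rw [hunc]; exact hHint)
  have hLHS : ∫ b in (1 : ℝ)..A, ∫ u in (0 : ℝ)..(2 * b), g u * g (2 * b - u) = ∫ b, ∫ u, H (b, u) := by
    simp_rw [hslice_b]
    rw [integral_indicator measurableSet_Ioo, intervalIntegral.integral_of_le hA, integral_Ioc_eq_integral_Ioo]
  have hIX : IntervalIntegrable (fun b : ℝ ↦ ∫ u in (0 : ℝ)..(2 * b), g u * g (2 * b - u)) volume 1 A := by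
    have hi : Integrable (fun b ↦ ∫ u, H (b, u)) := hHint.integral_prod_left
    simp_rw [hslice_b] at hi
    rw [intervalIntegrable_iff_integrableOn_Ioo_of_le hA]
    exact (integrable_indicator_iff measurableSet_Ioo).1 hi
  refine ⟨hIX, ?_⟩
  -- bound of the u-slices
  have hinner : ∀ u ∈ Ioo 0 (2 * A), |g u * ∫ b in Ioo (max 1 (u / 2)) A, g (2 * b - u)| ≤ C * |g u| := by
    intro u hu
    rw [abs_mul, mul_comm C]
    refine mul_le_mul_of_nonneg_left ?_ (abs_nonneg _)
    rcases le_or_gt A (max 1 (u / 2)) with hle | hlt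
    · rw [Ioo_eq_empty (not_lt.2 hle), Measure.restrict_empty, integral_zero_measure, abs_zero]; exact hC0
    · have hcu : 0 ≤ 2 * max 1 (u / 2) - u := by
        have := le_max_right 1 (u / 2); linarith
      rw [setIntegral_cramerFn_two_mul_sub hcu hlt.le]
      have h1 := hC (2 * A - u) (by linarith [hu.2])
      have h2 := hC (2 * max 1 (u / 2) - u) hcu
      rw [abs_mul, abs_of_pos (by norm_num : (0 : ℝ) < 1 / 2)]
      linarith [abs_sub (∫ v in (0 : ℝ)..(2 * A - u), g v) (∫ v in (0 : ℝ)..(2 * max 1 (u / 2) - u), g v)]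
  have hA2 : (0 : ℝ) ≤ 2 * A := by linarith
  have hgabs : IntervalIntegrable (fun u ↦ C * |g u|) volume 0 (2 * A) :=
    ((intervalIntegrable_cramerFn 0 (2 * A)).abs).const_mul C
  rw [hLHS, hswap]
  simp_rw [hslice_u]
  rw [integral_indicator measurableSet_Ioo, ← integral_Ioc_eq_integral_Ioo, ← intervalIntegral.integral_of_le hA2,
    ← intervalIntegral.integral_const_mul]
  refine (intervalIntegral.abs_integral_le_integral_abs hA2).trans ?_
  refine intervalIntegral.integral_mono_on hA2 ?_ hgabs fun u hu ↦ ?_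
  · -- |slice| is interval integrable: it is the absolute value of an integrable function (Fubini)
    have hi : Integrable (fun u ↦ ∫ b, H (b, u)) := hHint.integral_prod_right
    simp_rw [hslice_u] at hi
    have hi' : IntegrableOn (fun u ↦ g u * ∫ b in Ioo (max 1 (u / 2)) A, g (2 * b - u)) (Ioo 0 (2 * A)) :=
      (integrable_indicator_iff measurableSet_Ioo).1 hi
    rw [intervalIntegrable_iff_integrableOn_Ioo_of_le hA2]
    exact hi'.abs
  · rcases eq_or_lt_of_le hu.1 with h0 | h0
    · -- u = 0: the integrand value is irrelevant only a.e., but we bound it anyway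
      subst h0
      rcases le_or_gt A (max 1 (0 / 2 : ℝ)) with hle | hlt
      · rw [Ioo_eq_empty (not_lt.2 hle), Measure.restrict_empty, integral_zero_measure, mul_zero, abs_zero]
        positivity
      · have := hinner 0
        -- 0 ∉ Ioo 0 (2A); bound directly
        rw [abs_mul, mul_comm C]
        refine mul_le_mul_of_nonneg_left ?_ (abs_nonneg _)
        have hcu : 0 ≤ 2 * max 1 ((0 : ℝ) / 2) - 0 := by have := le_max_left (1 : ℝ) (0 / 2); linarith
        rw [setIntegral_cramerFn_two_mul_sub hcu hlt.le]
        have h1 := hC (2 * A - 0) (by linarith)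
        have h2 := hC (2 * max 1 ((0 : ℝ) / 2) - 0) hcu
        rw [abs_mul, abs_of_pos (by norm_num : (0 : ℝ) < 1 / 2)]
        linarith [abs_sub (∫ v in (0 : ℝ)..(2 * A - 0), g v) (∫ v in (0 : ℝ)..(2 * max 1 ((0 : ℝ) / 2) - 0), g v)]
    rcases eq_or_lt_of_le hu.2 with h2 | h2
    · rw [h2]
      rcases le_or_gt A (max 1 (2 * A / 2)) with hle | hlt
      · rw [Ioo_eq_empty (not_lt.2 hle), Measure.restrict_empty, integral_zero_measure, mul_zero, abs_zero]
        positivity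
      · exfalso; have := le_max_right 1 (2 * A / 2); linarith
    exact hinner u ⟨h0, h2⟩

end FloorResidualMean

end Summit.RiemannHypothesis.RiemannHypothesis.Theorems.WeilFormatC
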